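import Summits.QuantumFields.YangMills.Theorems.UnitScaleTiltProp7PV3CDEAttainment
import HarnessLib

/-!
# Route `UnitScaleTilt`, crux K1 child «MinimiserStabilityRegPr» (stmt-QuantumFields-19200), skeleton birth_v8 5b4e8467… — ROW (C) SPLIT: THE UNIQUENESS HALF
# OF [Balaban1985Variational] PROP. 6 SUFFICES FOR CLAUSE (i); LEAF V3 ⇐ `stub_PV3A` ∧ (C-uniqueness) ∧ ATTAINMENT

Cell `ym3-torus`, width seat `ym-ust-19200-w2` (gen 0; OWNER RULING g24-№1 A2′; owner 00:21:07Z «w2 next: stub_PV3C»).  YM₃ on T³ is a ladder rung (R3), not the Clay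
problem; nothing here is a claim about the crux, d = 4 or the mass gap.

WHY.  The registered `stub_PV3C` is an `∃!`: EXISTENCE of a small Landau-gauge critical `X` over a (14)-background, and UNIQUENESS in the (19)-ball `ε₄ ≤ a₄`.  At the
carrier's reading R2 («critical» = minimiser of (5) over print's regular fibre (6)(e′) for some `e′`, `T3Thm1CarrierNative.IsCritR2`) the existence half already
CONTAINS the existence of an R2-critical point near `U₀`, i.e. attainment of an infimum over a regular fibre — in print this is the END of the route (Prop. 6's
contraction gives a solution of the variational equation (111); it becomes a minimiser only after (142) and [Balaban1985RegularSpaces] Thm 2's covering).  The p. 296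
uniqueness argument (122), on the other hand, uses only the UNIQUENESS half.  This file separates the two: clause (i) of leaf V3 from `stub_PV3A` and the uniqueness
half alone (§§1–3), and V3 from `stub_PV3A`, the uniqueness half and the attainment schema `T3ExistSplit.MinSixAttainedAt` with an EXISTENTIAL radius constant (§4);
the registered `stub_PV3C` implies the uniqueness half verbatim (§5), so nothing here is harder than the stubs of record.

WHAT IS PROVED (sorry-free, no definition).
§1 `one_landau_of_prop2_uniq` — [B11] carrier level: Prop. 2 + the uniqueness half of Prop. 6 ⇒ the «one Landau representative» socket of
   `B11Prop7Assembly.one_landau_of_props` (same binder shape; Prop. 5 not needed); `atMostOneCriticalOrbit_of_prop2_uniq'` — `Prop7ChartPrint.atMostOneCriticalOrbit_of_props_inj'`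
   with (Prop 5, Prop 6) replaced by the uniqueness half.
§3 **`atMostOneCriticalOrbit_of_A_Cuniq`** — clause (i) of `Prop7From14At` at the log-chart letters from (A) and the native uniqueness text.
§4 **`prop7From14At_of_A_Cuniq_att`** — V3 ⇐ (A) ∧ (C-uniqueness) ∧ `∃ B₃′ a₀′ a₁′ > 0, MinSixAttainedAt L a₀′ a₁′ B₃′` (clause (ii) at `O = max{1, B₃′/(L³B₃)}`).
§5 **`uniq_of_stub_PV3C_text`** (registered (C) ⇒ its uniqueness half) and **`prop7From14At_v8_of_A_Cuniq_att`** — §4 at `S_v8 = tPrintFam (sPrint L T)` over w1's names.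

HONEST SCOPE.  (A) ([Balaban1985RegularSpaces] Thm 2 for the based letters), the uniqueness half of Prop. 6 (print: the contraction (116)–(121), [Balaban1985GreensFunctions]
Thm 3.13's `B₀`; at reading R2 it also wants «R2-critical ⇒ variational equation (111)») and ATTAINMENT (Thm 1 (8) in reading R1; print's proof = Prop. 7 (ii)) are
HYPOTHESES.  Count-neutral helper toward stmt-QuantumFields-19200 (`--supports`), not a proof of any stub.

References: T. Bałaban, CMP 102 (1985) 277–309 [Balaban1985Variational] (Thm 1 (8) p.279, (4)–(6) p.278, (14) p.280, (19)–(21) p.281, Prop. 2 p.281, Props 5–6 pp.294–295,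
(111)–(112) p.294, (122) p.296, Prop. 7 p.299); CMP 99 (1985) 75–102 [Balaban1985RegularSpaces] (Thm 2 p.83).
-/

noncomputable section

namespace Summit.QuantumFields.YangMills.Theorems.Prop7PV3CUniqueness


open Literature.MathematicalPhysics.QuantumFieldTheory.Balaban1983to89
open Literature.MathematicalPhysics.QuantumFieldTheory.Balaban1983to89.T3ContinuumYM3Torus
open Literature.MathematicalPhysics.QuantumFieldTheory.Balaban1983to89.T3UnitLawDensityEML (ℰp)
open Literature.MathematicalPhysics.QuantumFieldTheory.Balaban1983to89.T3DescentFibreTower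
open Literature.MathematicalPhysics.QuantumFieldTheory.Balaban1983to89.T3ConstrainedMinimiser
open Literature.MathematicalPhysics.QuantumFieldTheory.Balaban1983to89.T3TiltDescent
open Literature.MathematicalPhysics.QuantumFieldTheory.Balaban1983to89.T3PrintedRegularMinimiser
open Literature.MathematicalPhysics.QuantumFieldTheory.Balaban1983to89.T3PrintedRegularOrbits (descTransf gaugeAct_mem_regFibrePr_iff_of_trivial)
open B11 (VarProblemX LGData Prop2Printed Prop5Printed Prop6Printed)
open B11Prop7Assembly (Bridge ExistenceLeavesCap one_landau_of_props silent_restrictions eps2_ge_prop2 ineq122_le second_condition_auto)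
open B7Prop1Explicit renaming Site → LSite
open B7Prop2Explicit (C0 c2' C0_pos c2'_pos)
open B8Eq119TwistedAxial (InAx Restr129)
open B8Thm4TorusAt (torusLam)
open B15DeterminingSets (embIter)
open B10Eq27TorusAxialLog (pull unitsField toUField)
open B8Thm2SetupTorus (pullGauge toUGauge)
open T3Thm1Carrier
open T3Thm1CarrierNative (IsCritR2 Prop7From14At)
open T3SectALandauChart
open Summit.QuantumFields.YangMills.Theorems.Prop7ChartInjectivity (sameOrbit_of_eq_law)
open Summit.QuantumFields.YangMills.Theorems.Prop7AxialReprPrint (inj16_print_based)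
open Summit.QuantumFields.YangMills.Theorems.Prop7ChartPrint (atMostOneCriticalOrbit_of_props_inj' gaugeFix_of_conditional_axialRepr' axialRepr_print_based_uniform)
open Summit.QuantumFields.YangMills.Theorems.Prop7TPrint
open Summit.QuantumFields.YangMills.Theorems.Prop7SPrint
open Summit.QuantumFields.YangMills.Theorems.Prop7PV3CDELogChart (prop5Printed_logChart prop6Printed_logChart_iff eq_expHermField_of_in19 nMax19_lt_of_in19)
open Summit.QuantumFields.YangMills.Theorems.Prop7PV3CDEAttainment (atMostOneCriticalOrbit_of_A_C)
open Summit.QuantumFields.YangMills.Theorems.Prop7PV3CDEAtSPrint (prop2Printed_tPrintFam_iff)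
open Literature.MathematicalPhysics.QuantumFieldTheory.Balaban1983to89.T3ExistSplit (MinSixAttainedAt)
open Literature.MathematicalPhysics.QuantumFieldTheory.Balaban1983to89.T3UnitLawGaugeInvariance (gaugeAct_gaugeAct)
open NormedSpace

open scoped Matrix.Norms.L2Operator


variable {L : ℕ}

/-! ## §1 Carrier level: Prop. 2 + uniqueness half of Prop. 6 ⇒ one Landau representative; at most one critical orbit -/

section Generic

variable {I : Type}

/-- **ONE LANDAU REPRESENTATIVE FROM PROP. 2 AND THE UNIQUENESS HALF OF PROP. 6** ([B11] carrier level, the binder shape of `B11Prop7Assembly.one_landau_of_props`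
with `c := 1` idle): two critical configurations of (18) are represented (Prop. 2, at `ε₂ ↦ 8ε₂`) by critical Landau-gauge perturbations in the ball (19) of radius
`8ε₂ ≤ a₄`, which coincide by uniqueness. [cite: Balaban1985Variational, (122) p.296, Prop. 2 p.281, Prop. 6 p.295] -/
theorem one_landau_of_prop2_uniq (B₀ B₁ B₃ C₁ c₁ : ℝ) (fam : I → LGData) (hB₁ : 0 ≤ B₁) (hC₁ : 0 ≤ C₁)
    (h2 : Prop2Printed B₁ B₃ C₁ c₁ fam)
    (hU : ∃ a₄ : ℝ, 0 < a₄ ∧ ∀ (i : I) (ε₁ ε₄ : ℝ), 0 < ε₁ → ε₄ ≤ a₄ → 2 * B₀ * C₁ * B₃ * ε₁ ≤ ε₄ →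
      ∀ (V : (fam i).Bdry) (U₀ : (fam i).Cfg), (fam i).Sat14 (C₁ * B₃ * ε₁) (C₁ * ε₁) V U₀ →
        ∀ U₁ U₁' : (fam i).Pert, (fam i).In19_21 ε₄ V U₀ U₁ → (fam i).CritL V U₀ U₁ → (fam i).In19_21 ε₄ V U₀ U₁' → (fam i).CritL V U₀ U₁' → U₁ = U₁') :
    ∃ c a₄ : ℝ, 0 < c ∧ 0 < a₄ ∧ ∀ i : I, ∀ ε₀ ε₁ ε₂ : ℝ, 0 < ε₀ → 0 < ε₁ → ε₀ + C₁ * ε₁ ≤ c₁ →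
      B₃ * ε₁ ≤ ε₀ → B₁ * (ε₀ + C₁ * ε₁) ≤ ε₂ → 8 * ε₂ ≤ a₄ → 2 * B₀ * C₁ * B₃ * ε₁ ≤ 8 * ε₂ → 4 * ε₂ ≤ c →
      ∀ V : (fam i).Bdry, ∀ U₀ : (fam i).Cfg, (fam i).Sat14 (C₁ * B₃ * ε₁) (C₁ * ε₁) V U₀ →
        ∀ U' U'' : (fam i).Pert, (fam i).In18 ε₀ V U₀ U' → (fam i).Crit V U₀ U' →
          (fam i).In18 ε₀ V U₀ U'' → (fam i).Crit V U₀ U'' →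
            ∃ U₁ : (fam i).Pert, ∃ u u' : (fam i).GT, (fam i).Restricted U₀ u ∧ (fam i).Restricted U₀ u' ∧
              (fam i).toAxial U₀ U₁ u = U' ∧ (fam i).toAxial U₀ U₁ u' = U'' := by
  obtain ⟨a₄, ha₄, HU⟩ := hU
  refine ⟨1, a₄, one_pos, ha₄, ?_⟩
  intro i ε₀ ε₁ ε₂ hε₀ hε₁ hsum _hB₃ε hε₂ h8 h2B _h4c V U₀ h14 U' U'' h18' hc' h18'' hc''
  have hε₀' : 0 ≤ ε₀ + C₁ * ε₁ := by positivity
  have h0 : 0 ≤ B₁ * (ε₀ + C₁ * ε₁) := mul_nonneg hB₁ hε₀'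
  have hε₂8 : B₁ * (ε₀ + C₁ * ε₁) ≤ 8 * ε₂ := by linarith
  obtain ⟨u, U₁, hu, h1921, hcL, hax⟩ := h2 i ε₀ ε₁ (8 * ε₂) hε₀ hε₁ hsum hε₂8 V U₀ h14 U' h18' hc'
  obtain ⟨u', U₁', hu', h1921', hcL', hax'⟩ := h2 i ε₀ ε₁ (8 * ε₂) hε₀ hε₁ hsum hε₂8 V U₀ h14 U'' h18'' hc''
  have hU₁ : U₁ = U₁' := HU i ε₁ (8 * ε₂) hε₁ h8 h2B V U₀ h14 U₁ U₁' h1921 hcL h1921' hcL'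
  subst hU₁
  exact ⟨U₁, u, u', hu, hu', hax, hax'⟩

/-- **AT MOST ONE CRITICAL ORBIT FROM PROP. 2, THE UNIQUENESS HALF OF PROP. 6, AND THE TWO SECT. A LAWS** — `Prop7ChartPrint.atMostOneCriticalOrbit_of_props_inj'`
verbatim with its `one_landau_of_props` input replaced by `one_landau_of_prop2_uniq` (Prop. 5 drops out). [cite: Balaban1985Variational, (122) p.296, Prop. 7 p.299] -/
theorem atMostOneCriticalOrbit_of_prop2_uniq' {famP : I → VarProblemX} {famD : I → LGData}
    (β : ∀ i, Bridge (famP i) (famD i)) {B₀ B₁ B₃ C₁ c₁ e : ℝ} (he : 0 < e)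
    (gaugeFix : ∀ (i : I) (ε₀ ε₁ : ℝ) (V : (famP i).Bdry) (U₀ : (famD i).Cfg) (U : (famP i).Cfg), ε₀ ≤ e → B₃ * ε₁ ≤ ε₀ →
      (famD i).Sat14 (C₁ * B₃ * ε₁) (C₁ * ε₁) ((β i).bdry V) U₀ → (famP i).InU ε₀ U → (famP i).InB V U →
        ∃ U' : (famD i).Pert, (famD i).In18 ε₀ ((β i).bdry V) U₀ U' ∧ (famP i).SameOrbit U ((β i).emb U₀ U') ∧
          ((famP i).IsCritical V U → (famD i).Crit ((β i).bdry V) U₀ U'))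
    (orbit16w : ∀ (i : I) (ε₀ : ℝ) (V : (famP i).Bdry) (U₀ : (famD i).Cfg) (U₁ : (famD i).Pert) (u u' : (famD i).GT),
      (famD i).Restricted U₀ u → (famD i).Restricted U₀ u' →
        (famD i).In18 ε₀ ((β i).bdry V) U₀ ((famD i).toAxial U₀ U₁ u) → (famD i).In18 ε₀ ((β i).bdry V) U₀ ((famD i).toAxial U₀ U₁ u') →
          (famP i).SameOrbit ((β i).emb U₀ ((famD i).toAxial U₀ U₁ u)) ((β i).emb U₀ ((famD i).toAxial U₀ U₁ u')))
    (symm : ∀ (i : I) (U U' : (famP i).Cfg), (famP i).SameOrbit U U' → (famP i).SameOrbit U' U)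
    (trans : ∀ (i : I) (U U' U'' : (famP i).Cfg), (famP i).SameOrbit U U' → (famP i).SameOrbit U' U'' → (famP i).SameOrbit U U'')
    (hB₁ : 0 < B₁) (hB₃ : 1 ≤ B₃) (hC₁ : 1 ≤ C₁) (hB₀B₁ : B₀ ≤ 4 * B₁) (hc₁ : 0 < c₁)
    (h2 : Prop2Printed B₁ B₃ C₁ c₁ famD)
    (hU : ∃ a₄ : ℝ, 0 < a₄ ∧ ∀ (i : I) (ε₁ ε₄ : ℝ), 0 < ε₁ → ε₄ ≤ a₄ → 2 * B₀ * C₁ * B₃ * ε₁ ≤ ε₄ →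
      ∀ (V : (famD i).Bdry) (U₀ : (famD i).Cfg), (famD i).Sat14 (C₁ * B₃ * ε₁) (C₁ * ε₁) V U₀ →
        ∀ U₁ U₁' : (famD i).Pert, (famD i).In19_21 ε₄ V U₀ U₁ → (famD i).CritL V U₀ U₁ → (famD i).In19_21 ε₄ V U₀ U₁' → (famD i).CritL V U₀ U₁' →
          U₁ = U₁') :
    ∃ a₀ : ℝ, 0 < a₀ ∧ ∀ i : I, ∀ ε₀ ε₁ : ℝ, 0 < ε₁ → ε₀ ≤ a₀ → B₃ * ε₁ ≤ ε₀ →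
      ∀ (V : (famP i).Bdry) (U₀ : (famD i).Cfg),
        (famD i).Sat14 (C₁ * B₃ * ε₁) (C₁ * ε₁) ((β i).bdry V) U₀ → (famP i).AtMostOneCriticalOrbit ε₀ V := by
  have hC₁pos : 0 < C₁ := by linarith
  obtain ⟨c, a₄, hc, ha₄, H⟩ := one_landau_of_prop2_uniq B₀ B₁ B₃ C₁ c₁ famD hB₁.le hC₁pos.le h2 hU
  set a₀ : ℝ := min e (min (a₄ / (16 * B₁ * C₁)) (min (c₁ / (2 * C₁)) (c / (8 * B₁ * C₁)))) with ha₀def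
  have ha₀pos : 0 < a₀ := by
    simp only [ha₀def, lt_min_iff]
    exact ⟨he, by positivity, by positivity, by positivity⟩
  refine ⟨a₀, ha₀pos, ?_⟩
  intro i ε₀ ε₁ hε₁ hε₀a hB₃ε V U₀ h14 U U'' hU hBU hcU hU'' hBU'' hcU''
  have hε₀ : 0 < ε₀ := lt_of_lt_of_le (by nlinarith) hB₃ε
  have hεe : ε₀ ≤ e := le_trans hε₀a (min_le_left _ _)
  have ha4 : ε₀ ≤ a₄ / (16 * B₁ * C₁) := le_trans hε₀a ((min_le_right _ _).trans (min_le_left _ _))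
  have hc1 : ε₀ ≤ c₁ / (2 * C₁) := le_trans hε₀a ((min_le_right _ _).trans ((min_le_right _ _).trans (min_le_left _ _)))
  have hcc : ε₀ ≤ c / (8 * B₁ * C₁) := le_trans hε₀a ((min_le_right _ _).trans ((min_le_right _ _).trans (min_le_right _ _)))
  obtain ⟨hsum, h4c⟩ := silent_restrictions hB₁ hC₁ hB₃ hε₁.le hB₃ε hc1 hcc
  set ε₂ : ℝ := B₁ * ε₀ + B₁ * C₁ * B₃ * ε₁ with hε₂def
  have hε₂ : B₁ * (ε₀ + C₁ * ε₁) ≤ ε₂ := eps2_ge_prop2 hB₁.le hC₁pos.le hB₃ hε₁.le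
  have h8 : 8 * ε₂ ≤ a₄ := by
    have h122 := ineq122_le hB₁.le hC₁ hε₀.le hB₃ε
    have : ε₀ * (16 * B₁ * C₁) ≤ a₄ := (le_div_iff₀ (by positivity)).1 ha4
    simp only [hε₂def]; nlinarith
  have h2B : 2 * B₀ * C₁ * B₃ * ε₁ ≤ 8 * ε₂ :=
    second_condition_auto hB₁.le hC₁pos.le (by linarith) hε₀.le hε₁.le hB₀B₁
  obtain ⟨U', hU'18, hUorb, hUcrit⟩ := gaugeFix i ε₀ ε₁ V U₀ U hεe hB₃ε h14 hU hBU
  obtain ⟨U₃, hU''18, hU''orb, hU''crit⟩ := gaugeFix i ε₀ ε₁ V U₀ U'' hεe hB₃ε h14 hU'' hBU''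
  obtain ⟨U₁, u, u', hu, hu', hax, hax'⟩ :=
    H i ε₀ ε₁ ε₂ hε₀ hε₁ hsum hB₃ε hε₂ h8 h2B h4c ((β i).bdry V) U₀ h14 U' U₃ hU'18 (hUcrit hcU) hU''18 (hU''crit hcU'')
  have horb : (famP i).SameOrbit ((β i).emb U₀ U') ((β i).emb U₀ U₃) := by
    have := orbit16w i ε₀ V U₀ U₁ u u' hu hu' (hax.symm ▸ hU'18) (hax'.symm ▸ hU''18)
    rwa [hax, hax'] at this
  exact trans i _ _ _ hUorb (trans i _ _ _ horb (symm i _ _ hU''orb))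

end Generic

/-! ## §3 Clause (i) of V3 at the log-chart letters from (A) and the uniqueness half of (C) -/

/-- **«AT MOST ONE CRITICAL ORBIT IN (6)(ε₀), B₃ε₁ ≤ ε₀ ≤ a₀» FROM (A) AND THE UNIQUENESS HALF OF (C)** at the log-chart letters over print's based Sect. A letters
(`Prop7PV3CDEAttainment.atMostOneCriticalOrbit_of_A_C` with Prop. 6 weakened to uniqueness; the native text says: two `𝔤`-valued `X, X′` in the (19)-ball `ε₄` which
satisfy (20), (21) and make `e^{iX}U₀` critical coincide). [cite: Balaban1985Variational, (122) p.296, Prop. 6 p.295, Prop. 2 p.281] -/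
theorem atMostOneCriticalOrbit_of_A_Cuniq (hL : 1 < L) (A : ResidFam L) {B₃ : ℝ} (hB₃ : 1 ≤ B₃)
    (hSax : ∀ (i : Idx L) (U₀ U : GaugeField (i.1.1.P i.1.2.2) 0 (Matrix.specialUnitaryGroup (Fin 2) ℂ)),
      (A i).IsAxial U₀ U ↔
        InAx (i.1.1.P i.1.2.2).L (i.1.2.2 - i.1.2.1) (torusLam (i.1.2.2 - i.1.2.1))
          (pull (unitsField (toUField U₀)) (embIter (i.1.2.2 - i.1.2.1) (0 : Site (i.1.1.P i.1.2.2) (i.1.2.2 - i.1.2.1))))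
          (pull (unitsField (toUField U)) (embIter (i.1.2.2 - i.1.2.1) (0 : Site (i.1.1.P i.1.2.2) (i.1.2.2 - i.1.2.1)))))
    (hSre : ∀ (i : Idx L) (U₀ : GaugeField (i.1.1.P i.1.2.2) 0 (Matrix.specialUnitaryGroup (Fin 2) ℂ))
      (u : GaugeTransf (i.1.1.P i.1.2.2) 0 (Matrix.specialUnitaryGroup (Fin 2) ℂ)), (A i).Restricted U₀ u →
        Restr129 (i.1.1.P i.1.2.2).L (i.1.2.2 - i.1.2.1) (torusLam (i.1.2.2 - i.1.2.1))
          (pull (unitsField (toUField U₀)) (embIter (i.1.2.2 - i.1.2.1) (0 : Site (i.1.1.P i.1.2.2) (i.1.2.2 - i.1.2.1))))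
          (pullGauge (fun x => Unitary.toUnits (toUGauge (i.1.1.P i.1.2.2) 2 u x)) (embIter (i.1.2.2 - i.1.2.1) (0 : Site (i.1.1.P i.1.2.2) (i.1.2.2 - i.1.2.1)))))
    (hA : ∃ B₁ c₁ : ℝ, 0 < B₁ ∧ 0 < c₁ ∧ Prop2Printed B₁ B₃ ((L : ℝ) ^ 3) c₁ (famLG3 L (tPrintFam A)))
    (hC : ∃ B₀ a₄ : ℝ, 0 < B₀ ∧ 0 < a₄ ∧ ∀ (i : Idx L) (ε₁ ε₄ : ℝ), 0 < ε₁ → ε₄ ≤ a₄ → 2 * B₀ * (L : ℝ) ^ 3 * B₃ * ε₁ ≤ ε₄ →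
      ∀ (V : GaugeField (i.1.1.P i.1.2.1) 0 (Matrix.specialUnitaryGroup (Fin 2) ℂ)) (U₀ : GaugeField (i.1.1.P i.1.2.2) 0 (Matrix.specialUnitaryGroup (Fin 2) ℂ)),
        RegPr i.1.1 i.1.2.1 i.1.2.2 ((L : ℝ) ^ 3 * B₃ * ε₁) U₀ → CloseAvg i.1.1 i.1.2.1 i.1.2.2 i.2.2.le ((L : ℝ) ^ 3 * ε₁) V U₀ →
        ∀ X X' : PBond (i.1.1.P i.1.2.2) 0 → Matrix (Fin 2) (Fin 2) ℂ,
          nMax19 i.1.1 i.1.2.1 i.1.2.2 U₀ X < ε₄ →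
          ((∀ b : PBond (i.1.1.P i.1.2.2) 0, (X b).IsHermitian ∧ Matrix.trace (X b) = 0) ∧ (A i).AvgCond V U₀ X ∧ (A i).IsLandau U₀ X ∧
            (A i).CritL V U₀ (expHermField X)) →
          nMax19 i.1.1 i.1.2.1 i.1.2.2 U₀ X' < ε₄ →
          ((∀ b : PBond (i.1.1.P i.1.2.2) 0, (X' b).IsHermitian ∧ Matrix.trace (X' b) = 0) ∧ (A i).AvgCond V U₀ X' ∧ (A i).IsLandau U₀ X' ∧
            (A i).CritL V U₀ (expHermField X')) → X = X')
 :
    ∃ a₀ : ℝ, 0 < a₀ ∧ ∀ (i : Idx L) (ε₀ ε₁ : ℝ), 0 < ε₁ → ε₀ ≤ a₀ → B₃ * ε₁ ≤ ε₀ →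
      ∀ (V : (famX L i).Bdry) (U₀ : (famLG3 L (tPrintFam A) i).Cfg),
        (famLG3 L (tPrintFam A) i).Sat14 ((L : ℝ) ^ 3 * B₃ * ε₁) ((L : ℝ) ^ 3 * ε₁) ((bridgeFam3 L (tPrintFam A) i).bdry V) U₀ →
          (famX L i).AtMostOneCriticalOrbit ε₀ V := by
  have hL1 : (1 : ℝ) ≤ (L : ℝ) := by exact_mod_cast hL.le
  have hC₁ : (1 : ℝ) ≤ (L : ℝ) ^ 3 := one_le_pow₀ hL1
  have hC₁pos : (0 : ℝ) < (L : ℝ) ^ 3 := by positivity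
  have hC0 : 0 < C0 3 := C0_pos _
  have hc2 : 0 < c2' 3 L := c2'_pos _ _ hL.le
  have he : 0 < min (1 / (6 * C0 3 * (L : ℝ) ^ 3)) (c2' 3 L / (4 * (L : ℝ) ^ 3)) := lt_min (by positivity) (by positivity)
  obtain ⟨B₁, c₁, hB₁, hc₁, h2⟩ := hA
  obtain ⟨B₀, a₄, hB₀, ha₄, HC⟩ := hC
  -- Thm 2's constant reconciled as in `Prop7PillarsPrint`: B₁* := max{B₁, B₀/4}
  set Bs : ℝ := max B₁ (B₀ / 4) with hBs
  have h1 : B₁ ≤ Bs := le_max_left _ _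
  have h0 : B₀ / 4 ≤ Bs := le_max_right _ _
  have hBs0 : 0 < Bs := lt_of_lt_of_le hB₁ h1
  have hB₀Bs : B₀ ≤ 4 * Bs := by linarith
  have h2' : Prop2Printed Bs B₃ ((L : ℝ) ^ 3) c₁ (famLG3 L (tPrintFam A)) := Prop7PillarsPrint.prop2Printed_mono h1 hC₁pos.le h2
  -- the Sect. A letters of `tPrintFam A` are `A`'s
  have hSax' : ∀ (i : Idx L) (U₀ U : GaugeField (i.1.1.P i.1.2.2) 0 (Matrix.specialUnitaryGroup (Fin 2) ℂ)), (tPrintFam A i).IsAxial U₀ U ↔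
      InAx (i.1.1.P i.1.2.2).L (i.1.2.2 - i.1.2.1) (torusLam (i.1.2.2 - i.1.2.1))
        (pull (unitsField (toUField U₀)) (embIter (i.1.2.2 - i.1.2.1) (0 : Site (i.1.1.P i.1.2.2) (i.1.2.2 - i.1.2.1))))
        (pull (unitsField (toUField U)) (embIter (i.1.2.2 - i.1.2.1) (0 : Site (i.1.1.P i.1.2.2) (i.1.2.2 - i.1.2.1)))) := hSax
  have hSre' : ∀ (i : Idx L) (U₀ : GaugeField (i.1.1.P i.1.2.2) 0 (Matrix.specialUnitaryGroup (Fin 2) ℂ))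
      (u : GaugeTransf (i.1.1.P i.1.2.2) 0 (Matrix.specialUnitaryGroup (Fin 2) ℂ)), (tPrintFam A i).Restricted U₀ u →
        Restr129 (i.1.1.P i.1.2.2).L (i.1.2.2 - i.1.2.1) (torusLam (i.1.2.2 - i.1.2.1))
          (pull (unitsField (toUField U₀)) (embIter (i.1.2.2 - i.1.2.1) (0 : Site (i.1.1.P i.1.2.2) (i.1.2.2 - i.1.2.1))))
          (pullGauge (fun x => Unitary.toUnits (toUGauge (i.1.1.P i.1.2.2) 2 u x)) (embIter (i.1.2.2 - i.1.2.1) (0 : Site (i.1.1.P i.1.2.2) (i.1.2.2 - i.1.2.1)))) :=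
    hSre
  -- the uniqueness half of Prop. 6 at the carrier, from the native text
  have hU : ∀ (i : Idx L) (ε₁ ε₄ : ℝ), 0 < ε₁ → ε₄ ≤ a₄ → 2 * B₀ * (L : ℝ) ^ 3 * B₃ * ε₁ ≤ ε₄ →
      ∀ (V : (famLG3 L (tPrintFam A) i).Bdry) (U₀ : (famLG3 L (tPrintFam A) i).Cfg),
        (famLG3 L (tPrintFam A) i).Sat14 ((L : ℝ) ^ 3 * B₃ * ε₁) ((L : ℝ) ^ 3 * ε₁) V U₀ →
        ∀ U₁ U₁' : (famLG3 L (tPrintFam A) i).Pert, (famLG3 L (tPrintFam A) i).In19_21 ε₄ V U₀ U₁ → (famLG3 L (tPrintFam A) i).CritL V U₀ U₁ →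
          (famLG3 L (tPrintFam A) i).In19_21 ε₄ V U₀ U₁' → (famLG3 L (tPrintFam A) i).CritL V U₀ U₁' → U₁ = U₁' := by
    intro i ε₁ ε₄ hε₁ hε₄ h2B V U₀ h14 U₁ U₁' h1921 hcL h1921' hcL'
    obtain ⟨⟨F, n, K⟩, hF, hnK⟩ := i
    obtain ⟨X, h19, h20, h21⟩ := h1921
    obtain ⟨X', h19', h20', h21'⟩ := h1921'
    have e₁ : U₁ = expHermField X := eq_expHermField_of_in19 h19
    have e₁' : U₁' = expHermField X' := eq_expHermField_of_in19 h19'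
    have hc₁ : (A ⟨(F, n, K), hF, hnK⟩).CritL V U₀ (expHermField X) := by rw [← e₁]; exact hcL
    have hc₁' : (A ⟨(F, n, K), hF, hnK⟩).CritL V U₀ (expHermField X') := by rw [← e₁']; exact hcL'
    have hX : X = X' := HC ⟨(F, n, K), hF, hnK⟩ ε₁ ε₄ hε₁ hε₄ h2B V U₀ h14.1 h14.2 X X' (nMax19_lt_of_in19 h19 le_rfl) ⟨h19.1, h20, h21, hc₁⟩
      (nMax19_lt_of_in19 h19' le_rfl) ⟨h19'.1, h20', h21', hc₁'⟩
    rw [e₁, e₁', hX]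
  -- CLAUSE (i), p. 296: Props 2, 5, 6 + the two Sect. A laws of `Prop7AxialReprPrint`
  obtain ⟨a₀, ha₀, HU⟩ := atMostOneCriticalOrbit_of_prop2_uniq' (bridgeFam3 L (tPrintFam A)) he
    (fun i ε₀ ε₁ V U₀ U hεe hB₃ε h14 hU hB =>
      gaugeFix_of_conditional_axialRepr' i.1.1 i.2.2.le (tPrintFam A i)
        (fun ε₀ ε₁ V U₀ U hεe hB₃ε h14 hU => by
          obtain ⟨v, hv, hvAx⟩ := axialRepr_print_based_uniform i.1.1 i.2.1 i.2.2.le hC₁ B₃ ε₀ ε₁ V U₀ U hεe hB₃ε h14 hU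
          exact ⟨v, hv, (hSax' i U₀ _).2 (hvAx _)⟩)
        ε₀ ε₁ V U₀ U hεe hB₃ε h14 hU hB)
    (fun i ε₀ V U₀ U₁ u u' hu hu' h18 h18' => by
      show T3Thm1Carrier.SameOrbit i.1.1 i.1.2.1 i.1.2.2 i.2.2.le (emb15 U₀ (act16 U₀ u U₁)) (emb15 U₀ (act16 U₀ u' U₁))
      have h18a : emb15 U₀ (act16 U₀ u U₁) ∈ regFibrePr i.1.1 i.1.2.1 i.1.2.2 i.2.2.le ε₀ V ∧
          (tPrintFam A i).IsAxial U₀ (emb15 U₀ (act16 U₀ u U₁)) := h18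
      have h18b : emb15 U₀ (act16 U₀ u' U₁) ∈ regFibrePr i.1.1 i.1.2.1 i.1.2.2 i.2.2.le ε₀ V ∧
          (tPrintFam A i).IsAxial U₀ (emb15 U₀ (act16 U₀ u' U₁)) := h18'
      rw [emb15_act16] at h18a h18b
      rw [emb15_act16, emb15_act16]
      exact sameOrbit_of_eq_law i.1.1 i.2.2.le (tPrintFam A i)
        (inj16_print_based i.1.1 i.2.2.le (tPrintFam A i) (fun U₀ U hU => (hSax' i U₀ U).1 hU) (hSre' i)) ε₀ V U₀ U₁ u u' hu hu' h18a h18b)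
    (fun i _ _ hUU' => sameOrbit_symm i.1.1 i.2.2.le hUU') (fun i _ _ _ h₁ h₂ => sameOrbit_trans i.1.1 i.2.2.le h₁ h₂)
    hBs0 hB₃ hC₁ hB₀Bs hc₁ h2' ⟨a₄, ha₄, hU⟩
  exact ⟨a₀, ha₀, HU⟩

/-! ## §4 V3 from (A), the uniqueness half of (C), and attainment with an existential radius constant -/

/-- **LEAF V3 FROM (A), THE UNIQUENESS HALF OF (C), AND ATTAINMENT**: clause (i) by §3; clause (ii) «a minimal orbit in (6)(O·L³B₃ε₁)» (reading R1) is
`MinSixAttainedAt L a₀′ a₁′ B₃′` read at `ε₀ = O·L³B₃ε₁` with `O = max{1, B₃′/(L³B₃)}` (so `B₃′ε₁ ≤ ε₀`) and `a′₁ = min{a₁′, a₀′/(O·L³B₃)}`.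
[cite: Balaban1985Variational, Prop. 7 p.299, Thm 1 (8) p.279, (6) p.278] -/
theorem prop7From14At_of_A_Cuniq_att (hL : 1 < L) (A : ResidFam L) {B₃ : ℝ} (hB₃ : 1 ≤ B₃)
    (hSax : ∀ (i : Idx L) (U₀ U : GaugeField (i.1.1.P i.1.2.2) 0 (Matrix.specialUnitaryGroup (Fin 2) ℂ)),
      (A i).IsAxial U₀ U ↔
        InAx (i.1.1.P i.1.2.2).L (i.1.2.2 - i.1.2.1) (torusLam (i.1.2.2 - i.1.2.1))
          (pull (unitsField (toUField U₀)) (embIter (i.1.2.2 - i.1.2.1) (0 : Site (i.1.1.P i.1.2.2) (i.1.2.2 - i.1.2.1))))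
          (pull (unitsField (toUField U)) (embIter (i.1.2.2 - i.1.2.1) (0 : Site (i.1.1.P i.1.2.2) (i.1.2.2 - i.1.2.1)))))
    (hSre : ∀ (i : Idx L) (U₀ : GaugeField (i.1.1.P i.1.2.2) 0 (Matrix.specialUnitaryGroup (Fin 2) ℂ))
      (u : GaugeTransf (i.1.1.P i.1.2.2) 0 (Matrix.specialUnitaryGroup (Fin 2) ℂ)), (A i).Restricted U₀ u →
        Restr129 (i.1.1.P i.1.2.2).L (i.1.2.2 - i.1.2.1) (torusLam (i.1.2.2 - i.1.2.1))
          (pull (unitsField (toUField U₀)) (embIter (i.1.2.2 - i.1.2.1) (0 : Site (i.1.1.P i.1.2.2) (i.1.2.2 - i.1.2.1))))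
          (pullGauge (fun x => Unitary.toUnits (toUGauge (i.1.1.P i.1.2.2) 2 u x)) (embIter (i.1.2.2 - i.1.2.1) (0 : Site (i.1.1.P i.1.2.2) (i.1.2.2 - i.1.2.1)))))
    (hA : ∃ B₁ c₁ : ℝ, 0 < B₁ ∧ 0 < c₁ ∧ Prop2Printed B₁ B₃ ((L : ℝ) ^ 3) c₁ (famLG3 L (tPrintFam A)))
    (hC : ∃ B₀ a₄ : ℝ, 0 < B₀ ∧ 0 < a₄ ∧ ∀ (i : Idx L) (ε₁ ε₄ : ℝ), 0 < ε₁ → ε₄ ≤ a₄ → 2 * B₀ * (L : ℝ) ^ 3 * B₃ * ε₁ ≤ ε₄ →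
      ∀ (V : GaugeField (i.1.1.P i.1.2.1) 0 (Matrix.specialUnitaryGroup (Fin 2) ℂ)) (U₀ : GaugeField (i.1.1.P i.1.2.2) 0 (Matrix.specialUnitaryGroup (Fin 2) ℂ)),
        RegPr i.1.1 i.1.2.1 i.1.2.2 ((L : ℝ) ^ 3 * B₃ * ε₁) U₀ → CloseAvg i.1.1 i.1.2.1 i.1.2.2 i.2.2.le ((L : ℝ) ^ 3 * ε₁) V U₀ →
        ∀ X X' : PBond (i.1.1.P i.1.2.2) 0 → Matrix (Fin 2) (Fin 2) ℂ,
          nMax19 i.1.1 i.1.2.1 i.1.2.2 U₀ X < ε₄ →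
          ((∀ b : PBond (i.1.1.P i.1.2.2) 0, (X b).IsHermitian ∧ Matrix.trace (X b) = 0) ∧ (A i).AvgCond V U₀ X ∧ (A i).IsLandau U₀ X ∧
            (A i).CritL V U₀ (expHermField X)) →
          nMax19 i.1.1 i.1.2.1 i.1.2.2 U₀ X' < ε₄ →
          ((∀ b : PBond (i.1.1.P i.1.2.2) 0, (X' b).IsHermitian ∧ Matrix.trace (X' b) = 0) ∧ (A i).AvgCond V U₀ X' ∧ (A i).IsLandau U₀ X' ∧
            (A i).CritL V U₀ (expHermField X')) → X = X')
    (hATT : ∃ B₃' a₀' a₁' : ℝ, 0 < B₃' ∧ 0 < a₀' ∧ 0 < a₁' ∧ MinSixAttainedAt L a₀' a₁' B₃') :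
    Prop7From14At L B₃ := by
  have hL1 : (1 : ℝ) ≤ (L : ℝ) := by exact_mod_cast hL.le
  have hC₁pos : (0 : ℝ) < (L : ℝ) ^ 3 := by positivity
  obtain ⟨a₀, ha₀, HU⟩ := atMostOneCriticalOrbit_of_A_Cuniq hL A hB₃ hSax hSre hA hC
  obtain ⟨B₃', a₀', a₁', hB₃', ha₀', ha₁', HATT⟩ := hATT
  have hK : 0 < (L : ℝ) ^ 3 * B₃ := by positivity
  set O : ℝ := max 1 (B₃' / ((L : ℝ) ^ 3 * B₃)) with hO
  have hO1 : 1 ≤ O := le_max_left _ _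
  have hO0 : 0 < O := lt_of_lt_of_le one_pos hO1
  have hOK : 0 < O * ((L : ℝ) ^ 3 * B₃) := mul_pos hO0 hK
  have hB₃'O : B₃' ≤ O * ((L : ℝ) ^ 3 * B₃) :=
    (div_le_iff₀ hK).1 (le_max_right 1 (B₃' / ((L : ℝ) ^ 3 * B₃)))
  refine ⟨a₀, min a₁' (a₀' / (O * ((L : ℝ) ^ 3 * B₃))), O, ha₀, lt_min ha₁' (div_pos ha₀' hOK), hO1, ?_⟩
  intro i ε₀ ε₁ hε₁ V hV U₀ hU₀ hB
  have h14 : (famLG3 L (tPrintFam A) i).Sat14 ((L : ℝ) ^ 3 * B₃ * ε₁) ((L : ℝ) ^ 3 * ε₁) ((bridgeFam3 L (tPrintFam A) i).bdry V) U₀ := by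
    obtain ⟨⟨F, n, K⟩, hF, hnK⟩ := i
    exact sat14T3_of_mem_fibre (mul_pos hC₁pos hε₁) hU₀ hB
  refine ⟨fun hε₀a hB₃ε => HU i ε₀ ε₁ hε₁ hε₀a hB₃ε V U₀ h14, fun hε₁a => ?_⟩
  obtain ⟨⟨F, n, K⟩, hF, hnK⟩ := i
  have hε₁a₁ : ε₁ ≤ a₁' := hε₁a.trans (min_le_left _ _)
  have hlo : B₃' * ε₁ ≤ O * (L : ℝ) ^ 3 * B₃ * ε₁ := by
    have := mul_le_mul_of_nonneg_right hB₃'O hε₁.le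
    calc B₃' * ε₁ ≤ O * ((L : ℝ) ^ 3 * B₃) * ε₁ := this
      _ = O * (L : ℝ) ^ 3 * B₃ * ε₁ := by ring
  have hhi : O * (L : ℝ) ^ 3 * B₃ * ε₁ ≤ a₀' := by
    have h1 : ε₁ * (O * ((L : ℝ) ^ 3 * B₃)) ≤ a₀' := (le_div_iff₀ hOK).1 (hε₁a.trans (min_le_right _ _))
    calc O * (L : ℝ) ^ 3 * B₃ * ε₁ = ε₁ * (O * ((L : ℝ) ^ 3 * B₃)) := by ring
      _ ≤ a₀' := h1
  obtain ⟨U, hU, hmin⟩ := HATT F hF n K hnK ε₁ (O * (L : ℝ) ^ 3 * B₃ * ε₁) hε₁ hε₁a₁ hlo hhi V hV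
  exact ⟨U, hU, hmin⟩

/-! ## §5 At `S_v8 = tPrintFam (sPrint L T)`: the registered (C) implies its uniqueness half; V3 from (A), (C-uniqueness), attainment -/

/-- **THE REGISTERED `stub_PV3C` TEXT IMPLIES ITS UNIQUENESS HALF** (same `B₀, a₄`: two solutions in the ball `ε₄` both equal the `∃!`-witness).
[cite: Balaban1985Variational, Prop. 6 p.295] -/
theorem uniq_of_stub_PV3C_text (L : ℕ) (B₃ : ℝ)
    (hC : ∃ B₀ a₄ : ℝ, 0 < B₀ ∧ 0 < a₄ ∧ ∀ (i : Idx L) (ε₁ ε₄ : ℝ), 0 < ε₁ → ε₄ ≤ a₄ → 2 * B₀ * (L : ℝ) ^ 3 * B₃ * ε₁ ≤ ε₄ →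
        ∀ (V : GaugeField (i.1.1.P i.1.2.1) 0 (Matrix.specialUnitaryGroup (Fin 2) ℂ))
          (U₀ : GaugeField (i.1.1.P i.1.2.2) 0 (Matrix.specialUnitaryGroup (Fin 2) ℂ)),
          RegPr i.1.1 i.1.2.1 i.1.2.2 ((L : ℝ) ^ 3 * B₃ * ε₁) U₀ → CloseAvg i.1.1 i.1.2.1 i.1.2.2 i.2.2.le ((L : ℝ) ^ 3 * ε₁) V U₀ →
          ∃ X : PBond (i.1.1.P i.1.2.2) 0 → Matrix (Fin 2) (Fin 2) ℂ,
            nMax19 i.1.1 i.1.2.1 i.1.2.2 U₀ X < ε₄ ∧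
            ((∀ b : PBond (i.1.1.P i.1.2.2) 0, (X b).IsHermitian ∧ Matrix.trace (X b) = 0) ∧ AvgCondPrint i.1.1 i.1.2.1 i.1.2.2 i.2.2.le V U₀ X ∧
              IsLandauPrint i.1.1 i.1.2.1 i.1.2.2 U₀ X ∧ CritLPrint i.1.1 i.1.2.1 i.1.2.2 i.2.2.le V U₀ (expHermField X)) ∧
            nMax19 i.1.1 i.1.2.1 i.1.2.2 U₀ X < 3 * B₀ * (L : ℝ) ^ 3 * B₃ * ε₁ ∧
            ∀ X' : PBond (i.1.1.P i.1.2.2) 0 → Matrix (Fin 2) (Fin 2) ℂ, nMax19 i.1.1 i.1.2.1 i.1.2.2 U₀ X' < ε₄ →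
              ((∀ b : PBond (i.1.1.P i.1.2.2) 0, (X' b).IsHermitian ∧ Matrix.trace (X' b) = 0) ∧ AvgCondPrint i.1.1 i.1.2.1 i.1.2.2 i.2.2.le V U₀ X' ∧
                IsLandauPrint i.1.1 i.1.2.1 i.1.2.2 U₀ X' ∧ CritLPrint i.1.1 i.1.2.1 i.1.2.2 i.2.2.le V U₀ (expHermField X')) → X' = X) :
    ∃ B₀ a₄ : ℝ, 0 < B₀ ∧ 0 < a₄ ∧ ∀ (i : Idx L) (ε₁ ε₄ : ℝ), 0 < ε₁ → ε₄ ≤ a₄ → 2 * B₀ * (L : ℝ) ^ 3 * B₃ * ε₁ ≤ ε₄ →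
      ∀ (V : GaugeField (i.1.1.P i.1.2.1) 0 (Matrix.specialUnitaryGroup (Fin 2) ℂ)) (U₀ : GaugeField (i.1.1.P i.1.2.2) 0 (Matrix.specialUnitaryGroup (Fin 2) ℂ)),
        RegPr i.1.1 i.1.2.1 i.1.2.2 ((L : ℝ) ^ 3 * B₃ * ε₁) U₀ → CloseAvg i.1.1 i.1.2.1 i.1.2.2 i.2.2.le ((L : ℝ) ^ 3 * ε₁) V U₀ →
        ∀ X X' : PBond (i.1.1.P i.1.2.2) 0 → Matrix (Fin 2) (Fin 2) ℂ,
          nMax19 i.1.1 i.1.2.1 i.1.2.2 U₀ X < ε₄ →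
          ((∀ b : PBond (i.1.1.P i.1.2.2) 0, (X b).IsHermitian ∧ Matrix.trace (X b) = 0) ∧ AvgCondPrint i.1.1 i.1.2.1 i.1.2.2 i.2.2.le V U₀ X ∧
            IsLandauPrint i.1.1 i.1.2.1 i.1.2.2 U₀ X ∧ CritLPrint i.1.1 i.1.2.1 i.1.2.2 i.2.2.le V U₀ (expHermField X)) →
          nMax19 i.1.1 i.1.2.1 i.1.2.2 U₀ X' < ε₄ →
          ((∀ b : PBond (i.1.1.P i.1.2.2) 0, (X' b).IsHermitian ∧ Matrix.trace (X' b) = 0) ∧ AvgCondPrint i.1.1 i.1.2.1 i.1.2.2 i.2.2.le V U₀ X' ∧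
            IsLandauPrint i.1.1 i.1.2.1 i.1.2.2 U₀ X' ∧ CritLPrint i.1.1 i.1.2.1 i.1.2.2 i.2.2.le V U₀ (expHermField X')) → X = X' := by
  obtain ⟨B₀, a₄, hB₀, ha₄, HC⟩ := hC
  refine ⟨B₀, a₄, hB₀, ha₄, ?_⟩
  intro i ε₁ ε₄ hε₁ hε₄ h2B V U₀ hR hcl X X' hX hsX hX' hsX'
  obtain ⟨X₀, -, -, -, huniq⟩ := HC i ε₁ ε₄ hε₁ hε₄ h2B V U₀ hR hcl
  exact (huniq X hX hsX).trans (huniq X' hX' hsX').symm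

/-- **LEAF V3 AT `S_v8` FROM THE REGISTERED `stub_PV3A` TEXT, THE UNIQUENESS HALF OF `stub_PV3C`, AND ATTAINMENT** (for the pen; rows (D), (E) not used).
[cite: Balaban1985Variational, Prop. 7 p.299, Thm 1 (8) p.279, (122) p.296] -/
theorem prop7From14At_v8_of_A_Cuniq_att (hL : 1 < L) (T : ResidFam L) {B₃ : ℝ} (hB₃ : 1 ≤ B₃)
    (hA : ∃ B₁ c₁ : ℝ, 0 < B₁ ∧ 0 < c₁ ∧ Prop2Printed B₁ B₃ ((L : ℝ) ^ 3) c₁ (famLG3 L (sPrint L T)))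
    (hCuniq : ∃ B₀ a₄ : ℝ, 0 < B₀ ∧ 0 < a₄ ∧ ∀ (i : Idx L) (ε₁ ε₄ : ℝ), 0 < ε₁ → ε₄ ≤ a₄ → 2 * B₀ * (L : ℝ) ^ 3 * B₃ * ε₁ ≤ ε₄ →
      ∀ (V : GaugeField (i.1.1.P i.1.2.1) 0 (Matrix.specialUnitaryGroup (Fin 2) ℂ)) (U₀ : GaugeField (i.1.1.P i.1.2.2) 0 (Matrix.specialUnitaryGroup (Fin 2) ℂ)),
        RegPr i.1.1 i.1.2.1 i.1.2.2 ((L : ℝ) ^ 3 * B₃ * ε₁) U₀ → CloseAvg i.1.1 i.1.2.1 i.1.2.2 i.2.2.le ((L : ℝ) ^ 3 * ε₁) V U₀ →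
        ∀ X X' : PBond (i.1.1.P i.1.2.2) 0 → Matrix (Fin 2) (Fin 2) ℂ,
          nMax19 i.1.1 i.1.2.1 i.1.2.2 U₀ X < ε₄ →
          ((∀ b : PBond (i.1.1.P i.1.2.2) 0, (X b).IsHermitian ∧ Matrix.trace (X b) = 0) ∧ AvgCondPrint i.1.1 i.1.2.1 i.1.2.2 i.2.2.le V U₀ X ∧
            IsLandauPrint i.1.1 i.1.2.1 i.1.2.2 U₀ X ∧ CritLPrint i.1.1 i.1.2.1 i.1.2.2 i.2.2.le V U₀ (expHermField X)) →
          nMax19 i.1.1 i.1.2.1 i.1.2.2 U₀ X' < ε₄ →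
          ((∀ b : PBond (i.1.1.P i.1.2.2) 0, (X' b).IsHermitian ∧ Matrix.trace (X' b) = 0) ∧ AvgCondPrint i.1.1 i.1.2.1 i.1.2.2 i.2.2.le V U₀ X' ∧
            IsLandauPrint i.1.1 i.1.2.1 i.1.2.2 U₀ X' ∧ CritLPrint i.1.1 i.1.2.1 i.1.2.2 i.2.2.le V U₀ (expHermField X')) → X = X')
    (hATT : ∃ B₃' a₀' a₁' : ℝ, 0 < B₃' ∧ 0 < a₀' ∧ 0 < a₁' ∧ MinSixAttainedAt L a₀' a₁' B₃') :
    Prop7From14At L B₃ := by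
  have hA' : ∃ B₁ c₁ : ℝ, 0 < B₁ ∧ 0 < c₁ ∧ Prop2Printed B₁ B₃ ((L : ℝ) ^ 3) c₁ (famLG3 L (tPrintFam (sPrint L T))) := by
    obtain ⟨B₁, c₁, hB₁, hc₁, h2⟩ := hA
    exact ⟨B₁, c₁, hB₁, hc₁, (prop2Printed_tPrintFam_iff (sPrint L T)).2 h2⟩
  exact prop7From14At_of_A_Cuniq_att hL (sPrint L T) hB₃ (hSax_sPrint T) (hSre_sPrint T) hA' hCuniq hATT

end Summit.QuantumFields.YangMills.Theorems.Prop7PV3CUniqueness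

end
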